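import Summits.CriticalPhenomena.PercolationContinuityZ3.Theorems.PercAnnulusCrossingSlabThm31OfThree
import Literature.Probability.Percolation.SlabRSWLemma311Window
import HarnessLib

/-!
# RSW3 lane (lead GEN 39): NEWMAN–TASSION–WU'S THEOREM 3.1 AT `p_c(S_k)` FROM TWO GLUING-LAYER INPUTS —
# Theorem 3.8 (gluing of the minimal circuits of adjacent annuli) DISCHARGED by the circuit gluing layer

builds on p205010 (kernel theorem, internal audit signed; external expert review pending) — NOT used in this file.

Cell `prim-rsw3` (LANE 3), lead seat, gen 39.  Support file (`--supports stmt-CriticalPhenomena-4575`); no definitions, no named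
facts, no sorries.  p1's `NewmanTassionWu2017_thm31_of_three` (gen 30) takes three inputs of the gluing layer; its (H38) — NTW's
Theorem 3.8 (arXiv), the gluing of the minimal circuits of two adjacent annuli in the high-probability regime — is now a theorem
of the tree in the repaired window (`NTW17.h38_window`, `Literature/…/SlabCircuitLink.lean`: two applications of the CIRCUIT
GLUING LEMMA `circuitGlue_highProb` — one-column vertical surgery at the minimal circuit, no routing), and Lemma 3.11 / 3.13 (i) /
(3.60) consume it through the block structure unchanged (`NTW17.h360_of_three_inputs`, `Literature/…/SlabRSWLemma311Window.lean`).
Result: **NTW's Theorem 3.1 at `p_c(S_k)` (and the named fact `NewmanTassionWu2017_thm31`) from TWO inputs** — (H3) Case 3 of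
Theorem 3.14 (p2's exploration line) and (H317) Theorem 3.17 at `p_c(S_k)` — for any `m₀ ≥ 52`.

* `h360_slabCritical_of_h317`, `boxCrossingProperty_slabCritical_of_two` (per `k ≥ 1`), `NewmanTassionWu2017_thm31_of_two`.

References: C. M. Newman, V. Tassion, W. Wu, *Critical percolation and the minimal spanning tree in slabs*, Comm. Pure Appl. Math. 70
(2017) = arXiv:1512.09107, §3.2 (Theorem 3.8), §3.4 (Lemma 3.11), §3.7 (proof of Theorem 3.1) [NewmanTassionWu2017].
-/

noncomputable section

namespace Summit.CriticalPhenomena.PercolationContinuityZ3.Theorems.Crossing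

open MeasureTheory
open Literature.Probability.Percolation Literature.Probability.LatticeModels
open Literature.Probability.Percolation.NTW17

/-- **(H360) at `p_c(S_k)` from (H317) alone** (`k ≥ 1`, `m₀ ≥ 52`): (H38) by `h38_window`, (H310) by `h310_holds_uniform`,
(H39) by `prop39_one_highProb`, in the window `ε = p_c(S_k)/2`. [cite: NewmanTassionWu2017, §3.7 eq. (3.60) with Theorems 3.8, 3.10, Prop. 3.9] -/
theorem h360_slabCritical_of_h317 (k : ℕ) (hk : 1 ≤ k) {m₀ : ℕ} (hm₀ : 52 ≤ m₀)
    (h317 : ∀ η : ℝ, 0 < η →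
      (∀ δ : ℝ, 0 < δ → ∃ n : ℕ, 1 ≤ n ∧
        1 - δ ≤ crossingProb k (criticalProbIOf (slabGraph 3 k) (slabOrigin 3 k)) n (2 * n)) →
      ∃ n : ℕ, m₀ ≤ n ∧
        1 - η ≤ crossingProb k (criticalProbIOf (slabGraph 3 k) (slabOrigin 3 k)) (2 * n) (n - 1)) :
    ∃ c₂ : ℝ, 0 < c₂ ∧ ∀ n : ℕ, 1 ≤ n →
      (bondPercolation (slabGraph 3 k) (criticalProbIOf (slabGraph 3 k) (slabOrigin 3 k))).real
        (slabConn k (boxR 0 n 0 (2 * n)) {z | z.1 = 0} {z | z.1 = n}) ≤ 1 - c₂ := by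
  set pc : ℝ := criticalProb (slabGraph 3 k) (slabOrigin 3 k) with hpc
  have hpos : 0 < pc :=
    (criticalProb_zd_pos 3 (by norm_num)).trans (AizenmanGrimmett1991.criticalProb_zd_lt_criticalProb_slab_of_AG (d := 3) le_rfl k)
  have hhalf : pc ≤ 1 / 2 := Transplant.StairSlabLog.criticalProb_slab_le_half k
  set ε : ℝ := pc / 2 with hε
  have hε0 : 0 < ε := by rw [hε]; linarith
  have hεc : ε < pc := by rw [hε]; linarith
  have hc1 : pc ≤ 1 - ε := by rw [hε]; linarith
  obtain ⟨c₂, hc₂, h⟩ := h360_of_three_inputs (k := k) hε0 (le_trans (by norm_num) hm₀) hεc hc1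
    (h310_holds_uniform hk hm₀ ε hε0) (fun _η hη j _hj => prop39_one_highProb k hk hε0 hη j (le_trans (by norm_num) hm₀)) h317
  refine ⟨c₂, hc₂, fun n hn => ?_⟩
  have := h n hn
  rw [crossingProb_eq] at this
  push_cast at this
  exact this

/-- **NTW's Theorem 3.1 at `p_c(S_k)` from TWO gluing-layer inputs** ((H38) discharged by the circuit gluing layer, (H310) by
p1's corner gluings, (H39)/(H2) by the path gluing layer): (H3) (Case 3 of Thm 3.14 against p2's `evCase2`) and (H317) at
`p_c(S_k)`; `m₀ ≥ 52`. [cite: NewmanTassionWu2017, Theorem 3.1 (§3.7) with Theorems 3.8, 3.10] -/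
theorem boxCrossingProperty_slabCritical_of_two (k : ℕ) (hk : 1 ≤ k) {ρ₂ : ℕ} (hρ₂ : 2 ≤ ρ₂) {m₀ : ℕ} (hm₀ : 52 ≤ m₀)
    (hCase3 : ∀ x : ℝ, 0 < x → ∃ y : ℝ, 0 < y ∧ ∃ n₃ : ℕ, ∀ n : ℕ, n₃ ≤ n →
      x ≤ (bondPercolation (slabGraph 3 k) (criticalProbIOf (slabGraph 3 k) (slabOrigin 3 k))).real
        ((slabConn k (boxR 0 (7 * n) 0 (8 * n - 1)) {z | z.1 = 0} (sideSeg (7 * n) 0 (4 * n - 1)) ∩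
            slabConn k (boxR (-(7 * n)) (7 * n) 0 (13 * n - 1)) {z | z.2 = 0} (sideSeg (7 * n) (5 * n) (13 * n - 1))) ∩
          (slabConn k (boxR (-(7 * n)) (7 * n) 0 (13 * n - 1)) (sideSeg (7 * n) (5 * n) (13 * n - 1))
            (sideSeg (7 * n) 0 (4 * n - 1)))ᶜ ∩ (NTW17.evCase2 k ρ₂ n)ᶜ) →
      y ≤ (bondPercolation (slabGraph 3 k) (criticalProbIOf (slabGraph 3 k) (slabOrigin 3 k))).real
        (slabConn k (boxR 0 (14 * n) 0 (13 * n)) {z | z.1 = 0} {z | z.1 = 14 * n}))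
    (h317 : ∀ η : ℝ, 0 < η →
      (∀ δ : ℝ, 0 < δ → ∃ n : ℕ, 1 ≤ n ∧
        1 - δ ≤ crossingProb k (criticalProbIOf (slabGraph 3 k) (slabOrigin 3 k)) n (2 * n)) →
      ∃ n : ℕ, m₀ ≤ n ∧
        1 - η ≤ crossingProb k (criticalProbIOf (slabGraph 3 k) (slabOrigin 3 k)) (2 * n) (n - 1)) :
    BoxCrossingProperty k (criticalProbIOf (slabGraph 3 k) (slabOrigin 3 k)) :=
  boxCrossingProperty_slabCritical_of_case3 k hk hρ₂ hCase3 (h360_slabCritical_of_h317 k hk hm₀ h317)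

/-- **`NewmanTassionWu2017_thm31` from two gluing-layer inputs** (for every `k ≥ 1`; `m₀ ≥ 52`): (H3) and (H317).
[cite: NewmanTassionWu2017, Theorem 3.1 and §3.7, with Theorems 3.8, 3.10] -/
theorem NewmanTassionWu2017_thm31_of_two {ρ₂ : ℕ} (hρ₂ : 2 ≤ ρ₂) {m₀ : ℕ} (hm₀ : 52 ≤ m₀)
    (hCase3 : ∀ k : ℕ, 1 ≤ k → ∀ x : ℝ, 0 < x → ∃ y : ℝ, 0 < y ∧ ∃ n₃ : ℕ, ∀ n : ℕ, n₃ ≤ n →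
      x ≤ (bondPercolation (slabGraph 3 k) (criticalProbIOf (slabGraph 3 k) (slabOrigin 3 k))).real
        ((slabConn k (boxR 0 (7 * n) 0 (8 * n - 1)) {z | z.1 = 0} (sideSeg (7 * n) 0 (4 * n - 1)) ∩
            slabConn k (boxR (-(7 * n)) (7 * n) 0 (13 * n - 1)) {z | z.2 = 0} (sideSeg (7 * n) (5 * n) (13 * n - 1))) ∩
          (slabConn k (boxR (-(7 * n)) (7 * n) 0 (13 * n - 1)) (sideSeg (7 * n) (5 * n) (13 * n - 1))
            (sideSeg (7 * n) 0 (4 * n - 1)))ᶜ ∩ (NTW17.evCase2 k ρ₂ n)ᶜ) →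
      y ≤ (bondPercolation (slabGraph 3 k) (criticalProbIOf (slabGraph 3 k) (slabOrigin 3 k))).real
        (slabConn k (boxR 0 (14 * n) 0 (13 * n)) {z | z.1 = 0} {z | z.1 = 14 * n}))
    (h317 : ∀ k : ℕ, 1 ≤ k → ∀ η : ℝ, 0 < η →
      (∀ δ : ℝ, 0 < δ → ∃ n : ℕ, 1 ≤ n ∧
        1 - δ ≤ crossingProb k (criticalProbIOf (slabGraph 3 k) (slabOrigin 3 k)) n (2 * n)) →
      ∃ n : ℕ, m₀ ≤ n ∧
        1 - η ≤ crossingProb k (criticalProbIOf (slabGraph 3 k) (slabOrigin 3 k)) (2 * n) (n - 1)) :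
    NewmanTassionWu2017_thm31 :=
  fun k hk => boxCrossingProperty_slabCritical_of_two k hk hρ₂ hm₀ (hCase3 k hk) (h317 k hk)

end Summit.CriticalPhenomena.PercolationContinuityZ3.Theorems.Crossing

end
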